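import Literature.NumberTheory.PAdicHodge.HodgeTatePeriodRingData
import Literature.NumberTheory.PAdicHodge.UnramifiedCompletionEmbedding
import Literature.NumberTheory.GaloisRepresentations.UnramifiedAdmissible
import HarnessLib

/-!
# Unramified representations are Hodge–Tate (`B_HT`-admissible)

Continuation of `HodgeTatePeriodRingData` (the genuine datum `hodgeTatePeriodRingData hp`,
`B_HT(F) = ℂ_F[T;T⁻¹]`) and `UnramifiedCompletionEmbedding` (the `Γ_F`-equivariant embedding
`ι : 𝒪̂_{F_nr} → ℂ_F`). Feeding `ι` (composed with `ℂ_F ⊆ B_HT`) to the tree's general theorem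
`PeriodRingData.isAdmissible_of_unramified` (`UnramifiedAdmissible.lean`: an unramified `ℚ_p`-linear
representation of `Γ_F` is `𝔅`-admissible for every period-ring datum `𝔅` receiving `𝒪̂_{F_nr}`
equivariantly over `𝒪_F` — Lang's theorem / Hilbert 90 for `GL_n(𝒪̂_{F_nr})`) gives:

**Theorem** (`isAdmissible_hodgeTate_of_unramified`). Every continuous finite-dimensional
`ℚ_p`-linear representation of `Γ_F` on which the inertia group acts trivially is
`B_HT`-admissible, i.e. Hodge–Tate (Fontaine 1994, Exp. III §5; Sen: unramified, indeed potentially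
unramified, representations are Hodge–Tate of weight `0`). This is the `B_HT` form of clause (F3)
of `IsFontaineDatum` (`UnramifiedWeightsZero`, there for `B_dR`).

## References

* J.-M. Fontaine, *Représentations p-adiques semi-stables*, Astérisque 223 (1994), Exp. III §5
  (unramified ⇒ crystalline ⇒ de Rham ⇒ Hodge–Tate). [FontaineAsterisque223III]
* J.-M. Fontaine, Y. Ouyang, *Theory of p-adic Galois representations*, §5.1, Prop. 2.14
  (`ℂ`-admissible = potentially unramified, Sen). [FontaineOuyang2022]
-/

noncomputable section

open ValuativeRel Field UniformSpace

namespace Literature.NumberTheory.PAdicHodge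

open Literature.NumberTheory.GaloisRepresentations
open Literature.NumberTheory.GaloisRepresentations.IsNonarchimedeanLocalField

variable {F : Type} [Field F] [ValuativeRel F] [TopologicalSpace F] [IsNonarchimedeanLocalField F]
  {p : ℕ} [CharZero F] [Fact p.Prime] (hp : valuation F p < 1)

namespace HT

/-- `σ` acts on `ℂ_F ⊆ B_HT` (degree `0`) through its action on `ℂ_F`. [folklore] -/
theorem smul_algebraMap_C (σ : absoluteGaloisGroup F) (c : CompletedAlgClosure F) :
    σ • algebraMap (CompletedAlgClosure F) (HT hp) c = algebraMap (CompletedAlgClosure F) (HT hp) (σ • c) := by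
  rw [algebraMap_C_eq, algebraMap_C_eq, smul_mono, zpow_zero, mul_one]

/-- **`ι_HT : 𝒪̂_{F_nr} → ℂ_F ⊆ B_HT`**, the equivariant embedding into the Hodge–Tate ring.
[cite: FontaineOuyang2022, §5.1] -/
def iotaHT : maxUnramifiedCompletion F →+* HT hp :=
  (algebraMap (CompletedAlgClosure F) (HT hp)).comp (maxUnramifiedCompletion.toC F)

/-- `ι_HT` is `Γ_F`-equivariant. [folklore] -/
theorem smul_iotaHT (σ : absoluteGaloisGroup F) (x : maxUnramifiedCompletion F) :
    σ • iotaHT hp x = iotaHT hp (maxUnramifiedCompletion.galAut F σ x) := by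
  change σ • algebraMap (CompletedAlgClosure F) (HT hp) (maxUnramifiedCompletion.toC F x) =
    algebraMap (CompletedAlgClosure F) (HT hp) (maxUnramifiedCompletion.toC F (maxUnramifiedCompletion.galAut F σ x))
  rw [smul_algebraMap_C, smul_toC]

omit [CharZero F] [Fact p.Prime] in
/-- `ι_HT` restricted to `𝒪_F` is the structure map `𝒪_F → F → B_HT`. [folklore] -/
theorem iotaHT_algebraMap (a : 𝒪[F]) :
    iotaHT hp (algebraMap 𝒪[F] (maxUnramifiedCompletion F) a) = algebraMap F (HT hp) (a : F) := by
  change algebraMap (CompletedAlgClosure F) (HT hp) (maxUnramifiedCompletion.toC F (algebraMap 𝒪[F] _ a)) = _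
  rw [toC_algebraMap, ← IsScalarTower.algebraMap_apply F (CompletedAlgClosure F) (HT hp)]

end HT

/-- **Unramified representations are Hodge–Tate.** For every continuous finite-dimensional
`ℚ_p`-linear representation `ρ` of `Γ_F` on which the inertia group `I_F` acts trivially, `ρ` is
`B_HT(F)`-admissible: `dim_F (B_HT ⊗_{ℚ_p} ρ)^{Γ_F} = dim_{ℚ_p} ρ` (for the genuine Hodge–Tate
datum `hodgeTatePeriodRingData hp`, any `ℚ_p`-algebra structure on `F`). Tree theorem
`PeriodRingData.isAdmissible_of_unramified` with the equivariant embedding `𝒪̂_{F_nr} → ℂ_F ⊆ B_HT`.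
[cite: FontaineAsterisque223III, Exp. III §5] [cite: FontaineOuyang2022, §5.1] -/
theorem isAdmissible_hodgeTate_of_unramified [Algebra ℚ_[p] F]
    {V : Type} [AddCommGroup V] [Module ℚ_[p] V] [TopologicalSpace V] [IsTopologicalAddGroup V]
    [ContinuousSMul ℚ_[p] V] [T2Space V] [FiniteDimensional ℚ_[p] V]
    (ρ : ContinuousRep (absoluteGaloisGroup F) ℚ_[p] V)
    (hρ : ∀ σ ∈ absInertia F, ∀ v : V, ρ σ v = v) :
    (hodgeTatePeriodRingData hp).IsAdmissible ρ :=
  PeriodRingData.isAdmissible_of_unramified (hodgeTatePeriodRingData hp) (HT.iotaHT hp)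
    (fun σ x => HT.smul_iotaHT hp σ x) (fun a => HT.iotaHT_algebraMap hp a) ρ hρ

end Literature.NumberTheory.PAdicHodge

end
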